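import Summits.Langlands.Langlands.Theses.TwistControlLadder

/-!
# Glue of the layer-3 split (gen 1) of `TwistControlledHigherInduction` (route TwistControlLadder, lens-1-g15 `PrimeDegreeLadder`)

Closes the glue item of `route-Langlands-TwistControlLadder` generated by
`--split TwistControlledHigherInduction --glue-decl-name TwistControlledHigherInduction_of_primeDegreeSplit`:
`TwistControlledHigherInduction_of_primeDegreeSplit :
  CubicLowRankDescent → PrimitiveLargePrimeDescent → CriticalOrImprimitiveDescent → TwistControlledHigherInduction`.
Pure logic: excluded middle on «[K:K₀] prime ∧ n < [K:K₀]», on «π is a twisted base change from K₀ along K/K₀»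
(the text inlined in all three children, named below), on «n ≤ 2 ∧ [K:K₀] = 3», and on the UPGRADED family clause
(inlined in B and, negated, in C; named below).  This is the lens-1-g15 node proof
`TwistControlLadder.twistControlledHigherInduction_of_primeDegreeSplit` (decomp-langlands, 2026-08-30; certified in
nodes/lens-1-g15-PrimeDegreeLadder.lean, rc 0 · 0 sorry · axioms standard), over the tree's declarations.  (Census-1 g17 landing: the node's two helper `def`s naming the sub-texts are INLINED into the two `by_cases`, per critic row 180 a1, so the
file is a pure proof.)  ELABORATES ONLY AFTER the split edit has
rendered the three children and the glue decl into Theses/TwistControlLadder.lean — census-1: check the rendered decl names first.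
-/

set_option linter.dupNamespace false -- project-wide option; `Summit.Langlands.Langlands` is the mandated namespace

namespace Summit.Langlands.Langlands.Theorems

open scoped Classical
open Filter

/-- The glue item of the lens-1-g15 split of `TwistControlledHigherInduction`, proved. -/
theorem TwistControlledHigherInduction_of_primeDegreeSplit_proof :
    Summit.Langlands.Langlands.Theses.TwistControlLadder.TwistControlledHigherInduction_of_primeDegreeSplit := by
  intro hA hB hC K _ _ n hcpt hn K₀ _ _ _ hGal hCyc hBox T hReg ℓ _ ι hFam π hLalg hT
  by_cases hP : (Module.finrank K₀ K).Prime ∧ n < Module.finrank K₀ K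
  · by_cases hTBC : (∃ (h₀ : Literature.NumberTheory.Automorphic.isCompact_glFiniteIntegralLevel n K₀) (h₁ : Literature.NumberTheory.Automorphic.isCompact_glFiniteIntegralLevel 1 K) (π₀ : Literature.NumberTheory.Automorphic.CuspidalAutomorphicRepData n K₀ h₀) (χ : Literature.NumberTheory.Automorphic.AutomorphicRepData (Literature.NumberTheory.Automorphic.AutomorphyDatum.gl 1 K h₁)), π₀.1.IsLAlgebraic ∧ χ.IsLAlgebraic ∧ ∀ᶠ w : IsDedekindDomain.HeightOneSpectrum (NumberField.RingOfIntegers K) in Filter.cofinite, ∀ (u : IsDedekindDomain.HeightOneSpectrum (NumberField.RingOfIntegers K₀)) (α : Multiset ℂ) (c : ℂ), w.asIdeal.under (NumberField.RingOfIntegers K₀) = u.asIdeal → π₀.1.HasSatakeParamAt u α → χ.HasSatakeParamAt w {c} → π.1.HasSatakeParamAt w ((α.map (· ^ w.asIdeal.inertiaDeg (NumberField.RingOfIntegers K₀))).map (c * ·)))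
    · exact hC K n hcpt hn K₀ hGal hCyc hBox T hReg ℓ ι hFam π hLalg hT (Or.inr (Or.inl hTBC))
    · by_cases h23 : n ≤ 2 ∧ Module.finrank K₀ K = 3
      · exact hA K n hcpt hn K₀ hGal hCyc h23.1 h23.2 T hReg ℓ ι hFam π hLalg hT hTBC
      · by_cases hF : (∀ (π' : Literature.NumberTheory.Automorphic.CuspidalAutomorphicRepData n K hcpt), π'.1.IsLAlgebraic → π'.1.HasInfinityType T → ∀ (hK₀ : Literature.NumberTheory.Automorphic.isCompact_glFiniteIntegralLevel (n * Module.finrank K₀ K) K₀), ∃ (P : Literature.NumberTheory.Automorphic.AutomorphicRepData (Literature.NumberTheory.Automorphic.AutomorphyDatum.gl (n * Module.finrank K₀ K) K₀ hK₀)) (R : Literature.NumberTheory.GaloisRepresentations.FramedGaloisRep K₀ (PadicAlgCl ℓ) (n * Module.finrank K₀ K)), Literature.NumberTheory.Automorphic.IsAutomorphicInductionAlong π'.1 P ∧ (∀ (v : IsDedekindDomain.HeightOneSpectrum (NumberField.RingOfIntegers K₀)) (β : IsDedekindDomain.HeightOneSpectrum (NumberField.RingOfIntegers K) → Multiset ℂ),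 Algebra.IsUnramifiedIn (NumberField.RingOfIntegers K) v.asIdeal → (∀ w : IsDedekindDomain.HeightOneSpectrum (NumberField.RingOfIntegers K), w.asIdeal.under (NumberField.RingOfIntegers K₀) = v.asIdeal → π'.1.HasSatakeParamAt w (β w)) → ∃ α : Multiset ℂ, P.HasSatakeParamAt v α ∧ Literature.NumberTheory.Automorphic.satakePolynomial α = Literature.NumberTheory.Automorphic.inducedSatakePolynomial v β) ∧ R.toGaloisRep.IsSemisimple ∧ (P.W ≤ Literature.NumberTheory.Automorphic.cuspFormsGL (n * Module.finrank K₀ K) K₀ hK₀ → P.IsLAlgebraic → R.toGaloisRep.IsIrreducible) ∧ (∀ᶠ v : IsDedekindDomain.HeightOneSpectrum (NumberField.RingOfIntegers K₀) in Filter.cofinite, SatakeFrobCompatibleAt ι P R v) ∧ (∀ p : ℕ, p.Prime → p ≠ ℓ → ¬ ((p : ℤ) ∣ NumberField.discr K₀) → (∀ w : IsDedekindDomain.HeightOneSpectrum (NumberField.RingOfIntegers K₀), (p : NumberField.RingOfIntegers K₀) ∈ w.asIdeal → P.IsUnramifiedAt w) → ∀ w : IsDedekindDomain.HeightOneSpectrum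 (NumberField.RingOfIntegers K₀), (p : NumberField.RingOfIntegers K₀) ∈ w.asIdeal → SatakeFrobCompatibleAt ι P R w))
        · exact hB K n hcpt hn K₀ hGal hCyc hP.1 hP.2 h23 T hReg ℓ ι hF π hLalg hT hTBC
        · exact hC K n hcpt hn K₀ hGal hCyc hBox T hReg ℓ ι hFam π hLalg hT (Or.inr (Or.inr hF))
  · exact hC K n hcpt hn K₀ hGal hCyc hBox T hReg ℓ ι hFam π hLalg hT (Or.inl hP)

end Summit.Langlands.Langlands.Theorems
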